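import Summits.CriticalPhenomena.PercolationContinuityZ3.Theorems.Transplant.FKConnectivityAllQAntipodalX2WordsSigmaRows
import HarnessLib

/-!
# Connectivity correlation inequalities for `φ_{w,q}` — σ-WORDS, file 14: the matching on inert-free σ-words

Helper file (`--supports stmt-CriticalPhenomena-4575`), FK sub-lane `prim-bschramm-fk-2` (gen 13); builds on p205010 (kernel
theorem, internal audit signed; external expert review pending).  Pure finite combinatorics (memo `bschramm/FROM-fk-2-g13-WORD-HALL.md`
§1.3 and §7.2: the LIFT of Theorem A from type words to gen 12's σ-words).
`phiB` flips the free letters of the blocks outside a window; `sPhi v` uses the RULE-N window of the type word of `v`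
(`sWindow`); `blocks_sPhi`, `typeword_sPhi` (the type word of `sPhi v` is the type-level winner `(ι x).map swap`), and from
`wordHall_type`: `sPhi_winner` (winner, same run count), `sPhi_injective` (on losers), `sPhi_letterwise` (only `01 → 10` flips,
because the blocks outside the window are ground, `ruleN_window_hull`).
[cite: Grimmett2006, §3.9 (p. 63)]
-/

namespace Summit.CriticalPhenomena.PercolationContinuityZ3.Theorems

namespace FK

namespace X2Word

/-! ### The matching on inert-free σ-words: flip the free letters of the blocks outside the RULE-N window -/

section PhiBlocks

/-- `sflip` preserves the kind. [folklore] -/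
@[simp] theorem sflip_fst (l : SLetter) : (sflip l).1 = l.1 := by
  unfold sflip; split_ifs <;> rfl

/-- `sflip` is an involution. [folklore] -/
@[simp] theorem sflip_sflip (l : SLetter) : sflip (sflip l) = l := by
  obtain ⟨k, b, bb⟩ := l
  cases b <;> cases bb <;> simp [sflip, isFree]

/-- `sflip` preserves (non-)inertness. [folklore] -/
@[simp] theorem isInert_sflip (l : SLetter) : isInert (sflip l) = isInert l := by
  obtain ⟨k, b, bb⟩ := l
  cases k <;> cases b <;> cases bb <;> simp [sflip, isFree, isInert, sVisA, sVisB]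

/-- Flipping every letter of a block swaps its type: `E ↔ F`, `M ↦ M`. [folklore] -/
theorem tyOf_map_sflip (ls : List SLetter) (hne : ls ≠ []) : tyOf (ls.map sflip) = (tyOf ls).swap := by
  have h1 : (∀ l ∈ ls.map sflip, l.2 = (false, true)) ↔ (∀ l ∈ ls, l.2 = (true, false)) := by
    simp only [List.mem_map, forall_exists_index, and_imp, forall_apply_eq_imp_iff₂]
    apply forall_congr'; intro l; apply imp_congr_right; intro _
    obtain ⟨k, b, bb⟩ := l; cases b <;> cases bb <;> simp [sflip, isFree]
  have h2 : (∀ l ∈ ls.map sflip, l.2 = (true, false)) ↔ (∀ l ∈ ls, l.2 = (false, true)) := by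
    simp only [List.mem_map, forall_exists_index, and_imp, forall_apply_eq_imp_iff₂]
    apply forall_congr'; intro l; apply imp_congr_right; intro _
    obtain ⟨k, b, bb⟩ := l; cases b <;> cases bb <;> simp [sflip, isFree]
  rw [tyOf_eq, tyOf_eq]
  by_cases hL : ∀ l ∈ ls, l.2 = (false, true)
  · have hO : ¬ ∀ l ∈ ls, l.2 = (true, false) := fun hO => not_allLam_of_allOm hne hO hL
    rw [if_pos hL, if_neg (fun h => hO (h1.mp h)), if_pos (h2.mpr hL)]; rfl
  · by_cases hO : ∀ l ∈ ls, l.2 = (true, false)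
    · rw [if_neg hL, if_pos hO, if_pos (h1.mpr hO)]; rfl
    · rw [if_neg hL, if_neg hO, if_neg (fun h => hO (h1.mp h)), if_neg (fun h => hL (h2.mp h))]; rfl

/-- Apply `sflip` to the letters of the blocks with index outside `[s, t]`. [folklore] -/
def phiB (s t : ℕ) (L : List (Kind × List SLetter)) : List (Kind × List SLetter) :=
  L.mapIdx fun j b => (b.1, if s ≤ j ∧ j ≤ t then b.2 else b.2.map sflip)

/-- Consecutive blocks of a word have different kinds (index form). [folklore] -/
theorem blocks_alt (w : List SLetter) : ∀ (j : ℕ) (hj : j + 1 < (blocks w).length), ((blocks w)[j]).1 ≠ ((blocks w)[j + 1]'hj).1 := by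
  intro j hj
  rw [blocks_kind w j (by omega), blocks_kind w (j + 1) hj, kindAt_succ]
  cases kindAt (kind0 w) j <;> decide

/-- `blocks` inverts flattening on valid block lists (nonempty blocks of one kind each, consecutive kinds different). [folklore] -/
theorem blocks_flatMap (L : List (Kind × List SLetter)) (hL1 : ∀ b ∈ L, b.2 ≠ [] ∧ ∀ l ∈ b.2, l.1 = b.1)
    (hL2 : ∀ (j : ℕ) (hj : j + 1 < L.length), (L[j]).1 ≠ (L[j + 1]'hj).1) : blocks (L.flatMap fun b => b.2) = L := by
  induction L with
  | nil => rfl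
  | cons b L ih =>
    obtain ⟨k, ls⟩ := b
    have ih' := ih (fun b hb => hL1 b (List.mem_cons_of_mem _ hb)) (fun j hj => by
      have := hL2 (j + 1) (by simpa using hj); simpa using this)
    obtain ⟨hne, hk⟩ := hL1 (k, ls) (by simp)
    rw [List.flatMap_cons]
    -- peel the letters of the first block one by one
    have key : ∀ (ls₁ : List SLetter), (∀ l ∈ ls₁, l.1 = k) →
        blocks (ls₁ ++ L.flatMap fun b => b.2) = (if ls₁ = [] then L else (k, ls₁) :: L) := by
      intro ls₁ hk₁
      induction ls₁ with
      | nil => simpa using ih'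
      | cons l ls₁ ih₁ =>
        have hl : l.1 = k := hk₁ l (by simp)
        have ih₁' := ih₁ (fun l' hl' => hk₁ l' (List.mem_cons_of_mem _ hl'))
        rw [List.cons_append]
        simp only [blocks, ih₁']
        by_cases h0 : ls₁ = []
        · subst h0
          simp only [if_true]
          cases L with
          | nil => simp [hl]
          | cons b' L' =>
            obtain ⟨k', ls'⟩ := b'
            have hne' : k ≠ k' := by have := hL2 0 (by simp); simpa using this
            simp [hl, hne']
        · simp [h0, hl]
    have := key ls hk
    simpa [hne] using this

/-- `phiB` preserves validity (letters). [folklore] -/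
theorem phiB_letters (s t : ℕ) (L : List (Kind × List SLetter)) (hL1 : ∀ b ∈ L, b.2 ≠ [] ∧ ∀ l ∈ b.2, l.1 = b.1) :
    ∀ b ∈ phiB s t L, b.2 ≠ [] ∧ ∀ l ∈ b.2, l.1 = b.1 := by
  intro b hb
  unfold phiB at hb
  rw [List.mem_iff_getElem] at hb
  obtain ⟨j, hj, rfl⟩ := hb
  simp only [List.getElem_mapIdx, List.length_mapIdx] at hj ⊢
  obtain ⟨hne, hk⟩ := hL1 (L[j]) (List.getElem_mem hj)
  split_ifs
  · exact ⟨hne, hk⟩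
  · refine ⟨by simpa using hne, fun l hl => ?_⟩
    obtain ⟨l', hl', rfl⟩ := List.mem_map.mp hl
    rw [sflip_fst]; exact hk l' hl'

/-- `phiB` preserves validity (kinds). [folklore] -/
theorem phiB_alt (s t : ℕ) (L : List (Kind × List SLetter)) (hL2 : ∀ (j : ℕ) (hj : j + 1 < L.length), (L[j]).1 ≠ (L[j + 1]'hj).1) :
    ∀ (j : ℕ) (hj : j + 1 < (phiB s t L).length), ((phiB s t L)[j]).1 ≠ ((phiB s t L)[j + 1]'hj).1 := by
  intro j hj
  unfold phiB at hj ⊢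
  simp only [List.getElem_mapIdx, List.length_mapIdx] at hj ⊢
  exact hL2 j hj

/-- Types of `phiB`: swapped outside the window. [folklore] -/
theorem tyOf_phiB (s t : ℕ) (L : List (Kind × List SLetter)) (hL1 : ∀ b ∈ L, b.2 ≠ [] ∧ ∀ l ∈ b.2, l.1 = b.1) :
    (phiB s t L).map (fun b => tyOf b.2) = (L.map fun b => tyOf b.2).mapIdx (fun j ty => if s ≤ j ∧ j ≤ t then ty else ty.swap) := by
  apply List.ext_getElem (by simp [phiB])
  intro j h1 h2
  simp only [phiB, List.getElem_map, List.getElem_mapIdx]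
  split_ifs
  · rfl
  · exact tyOf_map_sflip _ (hL1 _ (List.getElem_mem _)).1

/-- `phiB` is an involution (for a fixed window). [folklore] -/
theorem phiB_phiB (s t : ℕ) (L : List (Kind × List SLetter)) : phiB s t (phiB s t L) = L := by
  apply List.ext_getElem (by simp [phiB])
  intro j h1 h2
  simp only [phiB, List.getElem_mapIdx]
  obtain ⟨k, ls⟩ := L[j]
  split_ifs <;> simp [List.map_map, Function.comp_def]

end PhiBlocks

/-! ### WORD-HALL for inert-free σ-words -/

section SigmaHall

/-- The RULE-N window of an inert-free σ-word, as a pair (`(1, 0)` = empty window for the fixed point). [folklore] -/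
def sWindow (v : List SLetter) : ℕ × ℕ := (ruleN (kind0 v) (typeword v)).getD (1, 0)

/-- The matched winner of an inert-free σ-word: flip the free letters of the blocks outside the RULE-N window. [folklore] -/
def sPhi (v : List SLetter) : List SLetter := (phiB (sWindow v).1 (sWindow v).2 (blocks v)).flatMap fun b => b.2

variable {v : List SLetter}

/-- Blocks of the matched word. [folklore] -/
theorem blocks_sPhi (v : List SLetter) : blocks (sPhi v) = phiB (sWindow v).1 (sWindow v).2 (blocks v) :=
  blocks_flatMap _ (phiB_letters _ _ _ (blocks_letters v)) (phiB_alt _ _ _ (blocks_alt v))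

/-- The matched word has the same first kind. [folklore] -/
theorem kind0_sPhi (v : List SLetter) : kind0 (sPhi v) = kind0 v := by
  unfold kind0; rw [blocks_sPhi]
  unfold phiB
  cases hb : blocks v with
  | nil => simp
  | cons b L => simp [List.mapIdx_cons]

/-- The type word of the matched word is the type-level winner `(ι x).map swap`. [folklore] -/
theorem typeword_sPhi (v : List SLetter) : typeword (sPhi v) = (iota (kind0 v) (typeword v)).map Ty.swap := by
  have h1 : typeword (sPhi v) =
      (typeword v).mapIdx (fun j ty => if (sWindow v).1 ≤ j ∧ j ≤ (sWindow v).2 then ty else ty.swap) := by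
    unfold typeword; rw [blocks_sPhi, tyOf_phiB _ _ _ (blocks_letters v)]
  rw [h1]
  unfold sWindow iota
  cases hr : ruleN (kind0 v) (typeword v) with
  | none =>
    show (typeword v).mapIdx (fun j ty => if 1 ≤ j ∧ j ≤ 0 then ty else ty.swap) = (typeword v).map Ty.swap
    apply List.ext_getElem (by simp)
    intro j h1 h2
    simp only [List.getElem_mapIdx, List.getElem_map]
    rw [if_neg (by omega)]
  | some st =>
    obtain ⟨s, t⟩ := st
    show (typeword v).mapIdx (fun j ty => if s ≤ j ∧ j ≤ t then ty else ty.swap) = (swapWin s t (typeword v)).map Ty.swap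
    apply List.ext_getElem (by simp [swapWin])
    intro j h1 h2
    simp only [List.getElem_mapIdx, List.getElem_map, swapWin]
    split_ifs <;> simp

/-- The matched word is inert-free if the word is. [folklore] -/
theorem sPhi_nonInert (hv : ∀ l ∈ v, isInert l = false) : ∀ l ∈ sPhi v, isInert l = false := by
  intro l hl
  unfold sPhi phiB at hl
  rw [List.mem_flatMap] at hl
  obtain ⟨b, hb, hlb⟩ := hl
  rw [List.mem_iff_getElem] at hb
  obtain ⟨j, hj, rfl⟩ := hb
  simp only [List.getElem_mapIdx, List.length_mapIdx] at hj hlb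
  have hmem : ∀ l' ∈ ((blocks v)[j]).2, isInert l' = false := by
    intro l' hl'
    apply hv; rw [← flatten_blocks v]
    exact List.mem_flatMap.mpr ⟨_, List.getElem_mem hj, hl'⟩
  split_ifs at hlb
  · exact hmem l hlb
  · obtain ⟨l', hl', rfl⟩ := List.mem_map.mp hlb
    rw [isInert_sflip]; exact hmem l' hl'

/-- **WORD-HALL for inert-free σ-words, part 1: the matched word is a winner with the same number of runs.** [folklore] -/
theorem sPhi_winner (hv : ∀ l ∈ v, isInert l = false) (hx : sIsLoser v = true) :
    sIsWinner (sPhi v) = true ∧ sRuns (sPhi v) = sRuns v := by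
  rw [sIsLoser_eq v hv] at hx
  obtain ⟨hw, hl, -, -⟩ := wordHall_type (kind0 v) (typeword v) hx
  rw [sIsWinner_eq _ (sPhi_nonInert hv), sRuns_eq _ (sPhi_nonInert hv), sRuns_eq _ hv, kind0_sPhi, typeword_sPhi]
  exact ⟨hw, hl⟩

/-- **Part 2: injectivity on losers.** [folklore] -/
theorem sPhi_injective {v₁ v₂ : List SLetter} (h₁ : ∀ l ∈ v₁, isInert l = false) (h₂ : ∀ l ∈ v₂, isInert l = false)
    (hx₁ : sIsLoser v₁ = true) (hx₂ : sIsLoser v₂ = true) (heq : sPhi v₁ = sPhi v₂) : v₁ = v₂ := by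
  rw [sIsLoser_eq _ h₁] at hx₁; rw [sIsLoser_eq _ h₂] at hx₂
  have hk : kind0 v₁ = kind0 v₂ := by rw [← kind0_sPhi v₁, heq, kind0_sPhi]
  have ht : (iota (kind0 v₁) (typeword v₁)).map Ty.swap = (iota (kind0 v₂) (typeword v₂)).map Ty.swap := by
    rw [← typeword_sPhi, ← typeword_sPhi, heq]
  rw [hk] at ht hx₁
  obtain ⟨-, -, hinj, -⟩ := wordHall_type (kind0 v₂) (typeword v₂) hx₂
  have hxx : typeword v₁ = typeword v₂ := hinj _ hx₁ ht
  have hwin : sWindow v₁ = sWindow v₂ := by unfold sWindow; rw [hk, hxx]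
  have hb : blocks v₁ = blocks v₂ := by
    have e1 : blocks (sPhi v₁) = phiB (sWindow v₂).1 (sWindow v₂).2 (blocks v₁) := by rw [blocks_sPhi, hwin]
    have e2 : blocks (sPhi v₂) = phiB (sWindow v₂).1 (sWindow v₂).2 (blocks v₂) := blocks_sPhi v₂
    have e : phiB (sWindow v₂).1 (sWindow v₂).2 (blocks v₁) = phiB (sWindow v₂).1 (sWindow v₂).2 (blocks v₂) := by
      rw [← e1, ← e2, heq]
    have := congrArg (phiB (sWindow v₂).1 (sWindow v₂).2) e
    rwa [phiB_phiB, phiB_phiB] at this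
  rw [← flatten_blocks v₁, ← flatten_blocks v₂, hb]

/-- The letterwise relation "unchanged, or a λ-letter flipped to ω" is reflexive on lists. [folklore] -/
theorem forall₂_lamFlip_refl (ls : List SLetter) :
    List.Forall₂ (fun a b : SLetter => b = a ∨ (a.2 = (false, true) ∧ b = (a.1, true, false))) ls ls := by
  induction ls with
  | nil => exact List.Forall₂.nil
  | cons a ls ih => exact List.Forall₂.cons (Or.inl rfl) ih

/-- Flipping a block of λ-letters is letterwise "λ ↦ ω". [folklore] -/
theorem forall₂_lamFlip_sflip (ls : List SLetter) (hall : ∀ l ∈ ls, l.2 = (false, true)) :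
    List.Forall₂ (fun a b : SLetter => b = a ∨ (a.2 = (false, true) ∧ b = (a.1, true, false))) ls (ls.map sflip) := by
  induction ls with
  | nil => exact List.Forall₂.nil
  | cons a ls ih =>
    refine List.Forall₂.cons ?_ (ih (fun l hl => hall l (List.mem_cons_of_mem _ hl)))
    right
    have ha := hall a (by simp)
    refine ⟨ha, ?_⟩
    obtain ⟨k, b, bb⟩ := a
    simp only at ha
    obtain ⟨rfl, rfl⟩ := Prod.mk.inj ha
    simp [sflip, isFree]

/-- Blockwise related block lists have related flattenings. [folklore] -/
theorem forall₂_flatMap_snd {R : SLetter → SLetter → Prop} (L P : List (Kind × List SLetter)) (hlen : L.length = P.length)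
    (h : ∀ (j : ℕ) (hj : j < L.length) (hj' : j < P.length), List.Forall₂ R (L[j]).2 (P[j]).2) :
    List.Forall₂ R (L.flatMap fun b => b.2) (P.flatMap fun b => b.2) := by
  induction L generalizing P with
  | nil =>
    cases P with
    | nil => exact List.Forall₂.nil
    | cons _ _ => simp at hlen
  | cons b L ih =>
    cases P with
    | nil => simp at hlen
    | cons b' P' =>
      rw [List.flatMap_cons, List.flatMap_cons]
      apply List.rel_append
      · exact h 0 (by simp) (by simp)
      · exact ih P' (by simpa using hlen) (fun j hj hj' => h (j + 1) (by simpa using hj) (by simpa using hj'))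

/-- **Part 3: letterwise, the matched word only flips λ-letters to ω** (outside the window the blocks are ground). [folklore] -/
theorem sPhi_letterwise (v : List SLetter) :
    List.Forall₂ (fun a b : SLetter => b = a ∨ (a.2 = (false, true) ∧ b = (a.1, true, false))) v (sPhi v) := by
  -- blocks outside the window are of type E
  have hE : ∀ (j : ℕ) (hj : j < (blocks v).length), ¬ ((sWindow v).1 ≤ j ∧ j ≤ (sWindow v).2) →
      tyOf ((blocks v)[j]).2 = .E := by
    intro j hj hout
    have hjt : j < (typeword v).length := by simpa [typeword] using hj
    have hxj : (typeword v)[j] = tyOf ((blocks v)[j]).2 := by simp [typeword]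
    rw [← hxj]
    unfold sWindow at hout
    cases hs : hullStart (typeword v) with
    | none => exact (hullStart_eq_none_iff _).mp hs _ (List.getElem_mem _)
    | some h =>
      cases he : hullEnd (typeword v) with
      | none =>
        exfalso
        have h1 := (hullEnd_eq_none_iff _).mp he
        rw [← hullStart_eq_none_iff] at h1; rw [h1] at hs; exact absurd hs (by simp)
      | some h' =>
        obtain ⟨_, _, hx2⟩ := (hullStart_eq_some_iff _ h).mp hs
        obtain ⟨_, _, hx2'⟩ := (hullEnd_eq_some_iff _ h').mp he
        cases hr : ruleN (kind0 v) (typeword v) with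
        | none =>
          exfalso
          unfold ruleN at hr; rw [hs, he] at hr; simp only at hr; split_ifs at hr
        | some st =>
          obtain ⟨s, t⟩ := st
          rw [hr] at hout
          obtain ⟨h1, h2⟩ := ruleN_window_hull hs he hr
          have hout' : ¬ (s ≤ j ∧ j ≤ t) := hout
          rcases not_and_or.mp hout' with ho | ho
          · exact hx2 j (by omega)
          · exact hx2' j hjt (by omega)
  unfold sPhi
  conv_lhs => rw [← flatten_blocks v]
  apply forall₂_flatMap_snd _ _ (by simp [phiB])
  intro j hj hj'
  simp only [phiB, List.getElem_mapIdx]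
  by_cases hin : (sWindow v).1 ≤ j ∧ j ≤ (sWindow v).2
  · rw [if_pos hin]; exact forall₂_lamFlip_refl _
  · rw [if_neg hin]
    apply forall₂_lamFlip_sflip
    have hty := hE j hj hin
    by_contra hc
    rw [tyOf_eq, if_neg hc] at hty
    split_ifs at hty

end SigmaHall


end X2Word

end FK

end Summit.CriticalPhenomena.PercolationContinuityZ3.Theorems
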